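import Summits.BirchSwinnertonDyer.Rank1Residual.X11b.ChaPairsMinimality
import HarnessLib

/-!
# BSD rank-≤1 residual cell, class X10b (N2) K-CM records: a fourth Kraus pattern at `2`
# (`2⁴ ‖ c₄`, `c₆ = 2⁶·L`, `L ≡ 1 (mod 4)`) and the global-minimality criterion it completes

HONEST FRAMING (cell `b2b-bsdres-*`, verbatim): prove what is provable now; shrink each hard class
to its core with data; no claim beyond stated classes; COMBINATION classes deleted from PUBLISHED
theorems only, CONSTRUCTION-shaped remainder typed; this is not "finishing BSD". Nothing here is
specific to BSD. Theorems only (no definition, no named fact). Unit `b2b-bsdres-x10` (gen 19).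

The per-pair K-CM records of N2 (`X10/CMPartnerRecords*.lean`) decide the global minimality of each
Cremona model in the kernel by `isGloballyMinimal_of_krausCriterion_bounded₂` (x11c, X11b/ChaPairsMinimality:
Silverman's `ord_q Δ < 12 ∨ ord_q c₄ < 4` or the Kraus patterns F2a / F2c / F3). Eleven of the 94 target
models — `48400bl1`, `71632h1`, `300080k1`, `358160bt1`, `358160bu1`, `369776r1`, `369776t1`, `431728i1`,
`431728k1`, `474320ip1`, `474320ix1` (all with `2⁴ ∣ N`) — have `ord₂ c₄ = 4`, `ord₂ c₆ = 6`,
`c₆/2⁶ ≡ 1 (mod 4)`, `ord₂ Δ ≥ 12`, which fits none of those patterns. This file adds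
* §1 `isMinimalAt_two_of_c₄_eq_16_mul` (pattern **F2d**): `W` integral at the place of `2` with
  `c₄ = 16·K`, `K` odd, `c₆ = 64·L`, `L ≡ 1 (mod 4)` is minimal at `2` — the only possible descent is
  `u = 2w` (`|c₄|₂ = 2⁻⁴ > 2⁻⁸`), and the descended invariants `c₄' = K w⁻⁴` (a unit, so `16 ∤ c₄'`)
  and `c₆' = L w⁻⁶ ≡ L ≡ 1 (mod 4)` (so `c₆' ≢ −1 (mod 4)`) fail Kraus's necessary condition at `2`
  (tree `kraus_two_of_integral` / `isMinimal_of_kraus_fails`, Kraus 1989 Prop. 2);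
* §2 `isGloballyMinimal_of_krausCriterion₃` / `…_bounded₃`: the global criterion of `ChaPairsMinimality`
  with F2d added (bounded form: `16 ∣ c₄ ∧ 32 ∤ c₄ ∧ 64 ∣ c₆ ∧ 4 ∣ c₆/64 − 1`), the shape `decide`
  evaluates in the records.

References: A. Kraus, Manuscripta Math. 65 (1989) Prop. 2 [Kraus1989]; J. E. Cremona, *Algorithms for
Modular Elliptic Curves* (1997) §3.2 (Laska–Kraus–Connell) [CremonaAlgorithms1997]; J. H. Silverman,
*AEC* (2009) III.1 Table 3.1, VII.1 Rem. 1.1 [SilvermanAEC2009].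
-/

set_option autoImplicit false

noncomputable section



open IsDedekindDomain NumberField Rat.HeightOneSpectrum WeierstrassCurve
  Literature.NumberTheory.EllipticCurves Literature.NumberTheory.GaloisRepresentations
  Literature.NumberTheory.EllipticCurves.Rank1Residual.X11RankOneCertificates
  Summit.BirchSwinnertonDyer.BirchSwinnertonDyer.Rank1Residual.X11RankOne
  Summit.BirchSwinnertonDyer.Rank1Residual.X11b

namespace Summit.BirchSwinnertonDyer.Rank1Residual.X10

/-! ### §1. Pattern F2d at the place of `2` -/

section Two

variable (v : HeightOneSpectrum (𝓞 ℚ)) (W : WeierstrassCurve ℚ)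

/-- **Minimality at `2`, pattern `c₄ = 2⁴K`, `K` odd, `c₆ = 2⁶L`, `L ≡ 1 (mod 4)` (F2d).** For `W / ℚ`
integral at the place `v` of `2`: `W` is minimal at `v`. Since `|c₄|₂ = 2⁻⁴ > 2⁻⁸` the only possible
descent is `u = 2w`, `w` a unit; then `c₄' = c₄/(16w⁴) = K w⁻⁴` is a unit (`|c₄'| = 1 > 2⁻⁴`: Kraus's
first alternative fails) and `c₆' = c₆/(64w⁶) = L w⁻⁶` has `c₆' + 1 = (w⁻⁶ − 1)L + (L − 1) + 2` of
valuation exactly `2⁻¹ > 2⁻²` (`|w⁻⁶ − 1| ≤ 2⁻³`, `|L − 1| ≤ 2⁻²`): the alternative `c₆' ≡ −1 (mod 4)`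
fails too (`isMinimal_of_kraus_fails`). Covers Cremona's models `48400bl1`, `71632h1`, `300080k1`,
`358160bt1`, `358160bu1`, `369776r1`, `369776t1`, `431728i1`, `431728k1`, `474320ip1`, `474320ix1`.
[cite: Kraus1989, Prop. 2] [cite: CremonaAlgorithms1997, §3.2 (Laska–Kraus–Connell)] -/
theorem isMinimalAt_two_of_c₄_eq_16_mul (hv : natGenerator v = 2) (hint : W.IsIntegralAt v)
    {K : ℤ} (hK : W.c₄ = 16 * K) (hKodd : ¬ (2 : ℤ) ∣ K)
    {L : ℤ} (hL : W.c₆ = 64 * L) (hL1 : (4 : ℤ) ∣ L - 1) : W.IsMinimalAt v := by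
  set F := v.adicCompletion ℚ with hF
  set Y : WeierstrassCurve F := W.baseChange F with hY
  haveI : Y.IsIntegral (v.adicCompletionIntegers ℚ) := hint
  have V2 := valued_two v hv
  have h20 : (2 : F) ≠ 0 := by
    intro h; rw [h, Valuation.map_zero] at V2; exact WithZero.coe_ne_zero V2.symm
  have V16 : Valued.v (16 : F) = WithZero.exp (-4 : ℤ) := by
    rw [show (16 : F) = 2 ^ 4 by norm_num, Valuation.map_pow, V2, ← WithZero.exp_nsmul]; norm_num
  have hYc4 : Y.c₄ = 16 * algebraMap ℚ F K := by
    rw [hY, WeierstrassCurve.baseChange, map_c₄, hK, map_mul]; norm_num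
  have hYc6 : Y.c₆ = 64 * algebraMap ℚ F L := by
    rw [hY, WeierstrassCurve.baseChange, map_c₆, hL, map_mul]; norm_num
  -- the integers `K` (odd) and `L` (`≡ 1 (mod 4)`, hence odd)
  have hLodd : ¬ (2 : ℤ) ∣ L := fun h ↦ by
    have h4 : (2 : ℤ) ∣ L - 1 := dvd_trans ⟨2, by norm_num⟩ hL1
    have : (2 : ℤ) ∣ 1 := by simpa using dvd_sub h h4
    norm_num at this
  set k : F := algebraMap ℚ F K with hk
  set l : F := algebraMap ℚ F L with hl
  have hVk : Valued.v k = 1 := valued_intCast_eq_one_of_odd v hv hKodd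
  have hVl : Valued.v l = 1 := valued_intCast_eq_one_of_odd v hv hLodd
  have hVl1 : Valued.v (l - 1) ≤ WithZero.exp (-2 : ℤ) := by
    have := valued_intCast_le_of_dvd v hv (n := L - 1) (e := 2) (by simpa using hL1)
    rwa [Int.cast_sub, map_sub, Int.cast_one, map_one] at this
  have hc₄ : WithZero.exp (-8 : ℤ) < Valued.v Y.c₄ := by
    rw [hYc4, Valuation.map_mul, V16, hVk, mul_one, WithZero.exp_lt_exp]; norm_num
  refine isMinimal_of_kraus_fails v hv Y hc₄ fun w hw H ↦ ?_
  have hw0 : w ≠ 0 := by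
    intro h; rw [h, Valuation.map_zero] at hw; exact zero_ne_one hw
  have hwi : Valued.v w⁻¹ = 1 := by rw [map_inv₀, hw, inv_one]
  have h16 : (16 : F) ≠ 0 := by
    rw [show (16 : F) = 2 ^ 4 by norm_num]; exact pow_ne_zero _ h20
  have h64 : (64 : F) ≠ 0 := by
    rw [show (64 : F) = 2 ^ 6 by norm_num]; exact pow_ne_zero _ h20
  -- the descended invariants
  set x : F := w⁻¹ ^ 4 * k with hx
  set y : F := w⁻¹ ^ 6 * l with hy
  have hxunit : Valued.v x = 1 := by
    rw [hx, Valuation.map_mul, Valuation.map_pow, hwi, one_pow, one_mul, hVk]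
  have hyunit : Valued.v y = 1 := by
    rw [hy, Valuation.map_mul, Valuation.map_pow, hwi, one_pow, one_mul, hVl]
  have he4 : Y.c₄ / (16 * w ^ 4) = x := by
    rw [hYc4, hx, div_eq_iff (mul_ne_zero h16 (pow_ne_zero 4 hw0)), inv_pow,
      show ((w ^ 4)⁻¹ * k) * (16 * w ^ 4) = 16 * k * ((w ^ 4)⁻¹ * w ^ 4) by ring,
      inv_mul_cancel₀ (pow_ne_zero 4 hw0), mul_one]
  have he6 : Y.c₆ / (64 * w ^ 6) = y := by
    rw [hYc6, hy, div_eq_iff (mul_ne_zero h64 (pow_ne_zero 6 hw0)), inv_pow,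
      show ((w ^ 6)⁻¹ * l) * (64 * w ^ 6) = 64 * l * ((w ^ 6)⁻¹ * w ^ 6) by ring,
      inv_mul_cancel₀ (pow_ne_zero 6 hw0), mul_one]
  rw [he4, he6] at H
  rcases H with ⟨h, -⟩ | h
  · -- `|x| = 1 > 2⁻⁴`
    rw [hxunit, ← WithZero.exp_zero, WithZero.exp_le_exp] at h
    norm_num at h
  · -- `y + 1 = ((w⁻⁶ - 1) l + (l - 1)) + 2` has valuation `2⁻¹ > 2⁻²`
    have h6 := valued_pow_six_sub_one_le v hv hwi
    have hsmall : Valued.v ((w⁻¹ ^ 6 - 1) * l + (l - 1)) ≤ WithZero.exp (-2 : ℤ) := by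
      refine Valuation.map_add_le _ ?_ hVl1
      rw [Valuation.map_mul, hVl, mul_one]
      exact h6.trans (by rw [WithZero.exp_le_exp]; norm_num)
    have hlt2 : Valued.v ((w⁻¹ ^ 6 - 1) * l + (l - 1)) < Valued.v (2 : F) := by
      rw [V2]; exact lt_of_le_of_lt hsmall (by rw [WithZero.exp_lt_exp]; norm_num)
    have hy1 : Valued.v (y + 1) = WithZero.exp (-1 : ℤ) := by
      have : y + 1 = ((w⁻¹ ^ 6 - 1) * l + (l - 1)) + 2 := by rw [hy]; ring
      rw [this, Valuation.map_add_eq_of_lt_right _ hlt2, V2]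
    rw [hy1, WithZero.exp_le_exp] at h
    norm_num at h

end Two

/-! ### §2. The global criterion with pattern F2d -/

/-- **An integer Weierstrass model is globally minimal when every prime `q` satisfies Silverman's
criterion (`q¹² ∤ Δ` or `q⁴ ∤ c₄`) or one of the Kraus patterns F2a (`2⁸ ∤ c₄ ∧ 2⁷ ∣ c₆`), F2c
(`2²⁴ ∤ Δ ∧ c₆ = 2¹⁰M, M odd`), F2d (`c₄ = 2⁴K, K odd, c₆ = 2⁶L, L ≡ 1 (mod 4)`), F3 (`3⁸ ‖ c₆`).**
[cite: SilvermanAEC2009, VII.1 Remark 1.1 and VIII.8] [cite: Kraus1989, Prop. 1 and Prop. 2] -/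
theorem isGloballyMinimal_of_krausCriterion₃ (a1 a2 a3 a4 a6 : ℤ)
    (h : ∀ q : ℕ, q.Prime →
      (¬ (q : ℤ) ^ 12 ∣ discOf [a1, a2, a3, a4, a6] ∨ ¬ (q : ℤ) ^ 4 ∣ c4Of [a1, a2, a3, a4, a6]) ∨
      (q = 2 ∧ ¬ (2 : ℤ) ^ 8 ∣ c4Of [a1, a2, a3, a4, a6] ∧ (2 : ℤ) ^ 7 ∣ c6Of [a1, a2, a3, a4, a6]) ∨
      (q = 2 ∧ ¬ (2 : ℤ) ^ 24 ∣ discOf [a1, a2, a3, a4, a6] ∧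
        ∃ M : ℤ, c6Of [a1, a2, a3, a4, a6] = 1024 * M ∧ ¬ (2 : ℤ) ∣ M) ∨
      (q = 2 ∧ ∃ K L : ℤ, c4Of [a1, a2, a3, a4, a6] = 16 * K ∧ ¬ (2 : ℤ) ∣ K ∧
        c6Of [a1, a2, a3, a4, a6] = 64 * L ∧ (4 : ℤ) ∣ L - 1) ∨
      (q = 3 ∧ (3 : ℤ) ^ 8 ∣ c6Of [a1, a2, a3, a4, a6] ∧ ¬ (3 : ℤ) ^ 9 ∣ c6Of [a1, a2, a3, a4, a6])) :
    (⟨a1, a2, a3, a4, a6⟩ : WeierstrassCurve ℚ).IsGloballyMinimal where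
  isIntegral := isIntegral_of_exists_lift (𝓞 ℚ) ⟨(a1 : 𝓞 ℚ), by simp⟩ ⟨(a2 : 𝓞 ℚ), by simp⟩
    ⟨(a3 : 𝓞 ℚ), by simp⟩ ⟨(a4 : 𝓞 ℚ), by simp⟩ ⟨(a6 : 𝓞 ℚ), by simp⟩
  isMinimal v := by
    set W : WeierstrassCurve ℚ := ⟨a1, a2, a3, a4, a6⟩ with hW
    have hle : ∀ m : ℤ, v.valuation ℚ (m : ℚ) ≤ 1 := fun m ↦ by
      have hm : (m : ℚ) = algebraMap (𝓞 ℚ) ℚ (m : 𝓞 ℚ) := by simp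
      rw [hm]
      exact v.valuation_le_one _
    have hint : W.IsIntegralAt v :=
      W.isIntegralAt_of_valuation_le_one v (hle a1) (hle a2) (hle a3) (hle a4) (hle a6)
    have hΔ : W.Δ = ((discOf [a1, a2, a3, a4, a6] : ℤ) : ℚ) := by
      simp only [hW, WeierstrassCurve.Δ, WeierstrassCurve.b₂, WeierstrassCurve.b₄, WeierstrassCurve.b₆,
        WeierstrassCurve.b₈, discOf, invariants]
      push_cast
      ring
    have hc4 : W.c₄ = ((c4Of [a1, a2, a3, a4, a6] : ℤ) : ℚ) := by
      simp only [hW, WeierstrassCurve.c₄, WeierstrassCurve.b₂, WeierstrassCurve.b₄, c4Of, invariants]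
      push_cast
      ring
    have hc6 : W.c₆ = ((c6Of [a1, a2, a3, a4, a6] : ℤ) : ℚ) := by
      simp only [hW, WeierstrassCurve.c₆, WeierstrassCurve.b₂, WeierstrassCurve.b₄, WeierstrassCurve.b₆,
        c6Of, invariants]
      push_cast
      ring
    haveI hYint : (W.baseChange (v.adicCompletion ℚ)).IsIntegral (v.adicCompletionIntegers ℚ) := hint
    have hYc4 : Valued.v (W.baseChange (v.adicCompletion ℚ)).c₄ = v.valuation ℚ W.c₄ := by
      rw [WeierstrassCurve.baseChange, map_c₄, WeierstrassCurve.valued_algebraMap_adicCompletion]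
    have hYc6 : Valued.v (W.baseChange (v.adicCompletion ℚ)).c₆ = v.valuation ℚ W.c₆ := by
      rw [WeierstrassCurve.baseChange, map_c₆, WeierstrassCurve.valued_algebraMap_adicCompletion]
    rcases h _ (prime_natGenerator v) with (h12 | h4) | ⟨h2, h8, h7⟩ | ⟨h2, h24, M, hM, hModd⟩ |
        ⟨h2, K, L, hK, hKodd, hL, hL1⟩ | ⟨h3, h8, h9⟩
    · exact isMinimalAt_of_lt_valuation_Δ_holds hint
        (by rw [hΔ]; exact exp_neg_lt_valuation_intCast_of_not_pow_dvd v h12)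
    · exact isMinimalAt_of_lt_valuation_c₄ hint
        (by rw [hc4]; exact exp_neg_lt_valuation_intCast_of_not_pow_dvd v h4)
    · -- pattern F2a at `2`
      refine isMinimal_two_of_valued_c₄_c₆ v h2 _ ?_ ?_
      · rw [hYc4, hc4]
        exact exp_neg_lt_valuation_intCast_of_not_pow_dvd v (by rw [h2]; exact_mod_cast h8)
      · rw [hYc6, hc6]
        exact_mod_cast Rat.valuation_intCast_le v (e := 7) (by rw [h2]; exact_mod_cast h7)
    · -- pattern F2c at `2`
      refine isMinimalAt_two_of_c₆_eq_1024_mul v W h2 hint ?_ (M := M) (by rw [hc6, hM]; push_cast; ring)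
        hModd
      rw [hΔ]
      exact_mod_cast exp_neg_lt_valuation_intCast_of_not_pow_dvd v (e := 24) (by rw [h2]; exact_mod_cast h24)
    · -- pattern F2d at `2`
      exact isMinimalAt_two_of_c₄_eq_16_mul v W h2 hint (K := K) (by rw [hc4, hK]; push_cast; ring) hKodd
        (L := L) (by rw [hc6, hL]; push_cast; ring) hL1
    · -- pattern F3 at `3`
      refine isMinimal_three_of_valued_c₆ v h3 _ ?_ ?_
      · rw [hYc6, hc6]
        exact_mod_cast Rat.valuation_intCast_le v (e := 8) (by rw [h3]; exact_mod_cast h8)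
      · rw [hYc6, hc6]
        exact_mod_cast exp_neg_lt_valuation_intCast_of_not_pow_dvd v (e := 9)
          (by rw [h3]; exact_mod_cast h9)

/-- **Bounded form** (the shape `decide` evaluates; the prime `2` is split off into its own hypothesis
`h2` to keep the `Decidable` instance small): `Δ ≠ 0`, `|Δ| < 512¹²`; at `q = 2`: Silverman's criterion or
pattern F2a / F2c / F2d; for every `3 ≤ q < 512`: Silverman's criterion or pattern F3; primes `q ≥ 512`
have `q¹² > |Δ|`. [cite: SilvermanAEC2009, VII.1 Remark 1.1] [cite: Kraus1989, Prop. 1 and Prop. 2] -/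
theorem isGloballyMinimal_of_krausCriterion_bounded₃ (a1 a2 a3 a4 a6 : ℤ)
    (h0 : discOf [a1, a2, a3, a4, a6] ≠ 0) (hB : (discOf [a1, a2, a3, a4, a6]).natAbs < 512 ^ 12)
    (h2 : ¬ 2 ^ 12 ∣ (discOf [a1, a2, a3, a4, a6]).natAbs ∨ ¬ 2 ^ 4 ∣ (c4Of [a1, a2, a3, a4, a6]).natAbs ∨
      (¬ (2 : ℤ) ^ 8 ∣ c4Of [a1, a2, a3, a4, a6] ∧ (2 : ℤ) ^ 7 ∣ c6Of [a1, a2, a3, a4, a6]) ∨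
      (¬ (2 : ℤ) ^ 24 ∣ discOf [a1, a2, a3, a4, a6] ∧ (1024 : ℤ) ∣ c6Of [a1, a2, a3, a4, a6] ∧
        ¬ (2 : ℤ) ∣ c6Of [a1, a2, a3, a4, a6] / 1024) ∨
      ((16 : ℤ) ∣ c4Of [a1, a2, a3, a4, a6] ∧ ¬ (2 : ℤ) ∣ c4Of [a1, a2, a3, a4, a6] / 16 ∧
        (64 : ℤ) ∣ c6Of [a1, a2, a3, a4, a6] ∧ (4 : ℤ) ∣ c6Of [a1, a2, a3, a4, a6] / 64 - 1))
    (h : ∀ q < 512, q < 3 ∨ ¬ q ^ 12 ∣ (discOf [a1, a2, a3, a4, a6]).natAbs ∨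
      ¬ q ^ 4 ∣ (c4Of [a1, a2, a3, a4, a6]).natAbs ∨
      (q = 3 ∧ (3 : ℤ) ^ 8 ∣ c6Of [a1, a2, a3, a4, a6] ∧ ¬ (3 : ℤ) ^ 9 ∣ c6Of [a1, a2, a3, a4, a6])) :
    (⟨a1, a2, a3, a4, a6⟩ : WeierstrassCurve ℚ).IsGloballyMinimal := by
  refine isGloballyMinimal_of_krausCriterion₃ a1 a2 a3 a4 a6 fun q hq ↦ ?_
  have hpos : 0 < (discOf [a1, a2, a3, a4, a6]).natAbs := Int.natAbs_pos.mpr h0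
  by_cases hq2 : q = 2
  · subst hq2
    rcases h2 with h12 | h4 | hF2a | ⟨h24, h1024, hodd⟩ | ⟨h16, hKodd, h64, hL1⟩
    · refine Or.inl (Or.inl fun h12' ↦ h12 ?_)
      rw [← Int.natCast_dvd]; exact_mod_cast h12'
    · refine Or.inl (Or.inr fun h4' ↦ h4 ?_)
      rw [← Int.natCast_dvd]; exact_mod_cast h4'
    · exact Or.inr (Or.inl ⟨rfl, hF2a⟩)
    · refine Or.inr (Or.inr (Or.inl ⟨rfl, h24, c6Of [a1, a2, a3, a4, a6] / 1024, ?_, hodd⟩))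
      exact (Int.mul_ediv_cancel' h1024).symm
    · refine Or.inr (Or.inr (Or.inr (Or.inl ⟨rfl, c4Of [a1, a2, a3, a4, a6] / 16,
        c6Of [a1, a2, a3, a4, a6] / 64, ?_, hKodd, ?_, hL1⟩)))
      · exact (Int.mul_ediv_cancel' h16).symm
      · exact (Int.mul_ediv_cancel' h64).symm
  by_cases hqB : q < 512
  · rcases h q hqB with hlt | h12 | h4 | hF3
    · exfalso
      have := hq.two_le
      interval_cases q; simp_all
    · refine Or.inl (Or.inl fun h12' ↦ h12 ?_)
      rw [← Int.natCast_dvd]; exact_mod_cast h12'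
    · refine Or.inl (Or.inr fun h4' ↦ h4 ?_)
      rw [← Int.natCast_dvd]; exact_mod_cast h4'
    · exact Or.inr (Or.inr (Or.inr (Or.inr hF3)))
  · refine Or.inl (Or.inl fun h12 ↦ ?_)
    have h12' : q ^ 12 ∣ (discOf [a1, a2, a3, a4, a6]).natAbs := by
      rw [← Int.natCast_dvd]; exact_mod_cast h12
    have hle : q ^ 12 ≤ (discOf [a1, a2, a3, a4, a6]).natAbs := Nat.le_of_dvd hpos h12'
    have hge : 512 ^ 12 ≤ q ^ 12 := Nat.pow_le_pow_left (by omega) 12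
    omega

/-- Instance of the bounded criterion with F2d: Cremona's model `358160bt1 = [0, 1, 0, 9464, 719860]`
(`ord₂ c₄ = 4`, `ord₂ c₆ = 6`, `c₆/64 ≡ 1 (mod 4)`, `ord₂ Δ = 15`) is globally minimal (kernel).
[cite: SilvermanAEC2009, VII.1 Remark 1.1] [cite: Cremona2006, Table 1 (Cremona label 358160bt1)] -/
theorem isGloballyMinimal_t358160bt1 : (⟨0, 1, 0, 9464, 719860⟩ : WeierstrassCurve ℚ).IsGloballyMinimal :=
  isGloballyMinimal_of_krausCriterion_bounded₃ 0 1 0 9464 719860 (by decide +kernel) (by decide +kernel)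
    (by decide +kernel) (by decide +kernel)

end Summit.BirchSwinnertonDyer.Rank1Residual.X10

end
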